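import Summits.AtomisticToContinuum.Crystallization.Theorems.ContactSaturationLadderSparseCutC
import Summits.AtomisticToContinuum.Crystallization.Theorems.ContactSaturationLadderCoveringRungSharp

/-!
# ContactSaturationLadder · §50 `DefectMarker50` — the two METRIC DEFECT markers (θ-microvoids, p-compressed pairs)
(decomp-a2c lens-1 g37, LANDABLE PART of node `LooseTextureRung_node_g37.lean` §50 = `build/scratch50.lean` sha256 df9faf9c…,
body byte-identical; namespace moved from the node's `…Theses.EquilibriumHalo` to this Theorems module; landed by hand-2 g12, LOW lane,
`--supports stmt-AtomisticToContinuum-30303 --as helper`).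
-/

noncomputable section

namespace Summit.AtomisticToContinuum.Crystallization.Theorems.ContactSaturationLadderDefectMarker

section DefectMarker50

open scoped BigOperators Classical
open Metric Filter
open Literature.MathematicalPhysics.StatisticalMechanics (lennardJones IsGroundState)
open Literature.Geometry.DiscreteGeometry (FejesToth1943_sphereCovering)
open Summit.AtomisticToContinuum.Crystallization.Theorems
open Summit.AtomisticToContinuum.Crystallization.Theorems.ContactSaturationLadderHaloCount (voidAdjSet)
open Summit.AtomisticToContinuum.Crystallization.Theorems.ContactSaturationLadderChunkDoor (NoLooseChunks SiteMarker)
open Summit.AtomisticToContinuum.Crystallization.Theorems.ContactSaturationLadderToleranceFloor (UniformlyTightF looseSetF NoLooseChunkAtF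
  NoLooseChunksF BandChunkAtF BandExclusionF bandExclusionF_of_noLooseChunksF noLooseChunksF_mono noLooseChunksF_of_noLooseChunks
  looseSetF_anti_slack noLooseChunksF_iff_band noLooseChunksF_of_band)
open Summit.AtomisticToContinuum.Crystallization.Theorems.ContactSaturationLadderGeometricTop (BallCoveringBound)
open Summit.AtomisticToContinuum.Crystallization.Theorems.ContactSaturationLadderCoveringRung (ballCoveringBound_eight_fifths_of_sphereCovering)
open Summit.AtomisticToContinuum.Crystallization.Theorems.ContactSaturationLadderCoveringRungSharp (noLooseChunksF_27_10_of_sphereCovering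
  noLooseChunksF_two_iff_band27_of_sphereCovering bandExclusionF_two_11_4_iff_27_10_of_sphereCovering)
open Summit.AtomisticToContinuum.Crystallization.Theorems.LjLaminarWindowsSketch (lennardJones_groundState_dist_ge_seven_tenths)
open Summit.AtomisticToContinuum.Crystallization.Theorems.ContactSaturationLadderSparseCut

/-! ### §50.1 The two METRIC DEFECT markers: `θ`-microvoids and `p`-compressed pairs -/

/-- **`microvoidMarker θ`** — the particles that are `θ`-MICROVOID-ADJACENT: some point within distance `2` of the particle is the centre of an
ATOM-FREE ball of radius `θ` (every particle at distance `≥ θ` from it).  `microvoidMarker 1 = voidAdjSet 2` (the 2-void-adjacent particles of C's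
hypothesis); for `θ < 1` the marker sees SUB-UNIT porosity: in fcc of spacing `a` the largest hole has radius `a/√2` (octahedral), so fcc(a) is
`θ`-microvoid-free iff `a < √2·θ` (`θ = 7/10`: `a < 0.99`; `θ = 4/5`: `a < 1.131`), while a VACANCY is an atom-free ball of radius `a`. -/
def microvoidMarker (θ : ℝ) : SiteMarker := fun N y =>
  Finset.univ.filter fun i : Fin N => ∃ x : EuclideanSpace ℝ (Fin 3), dist x (y i) ≤ 2 ∧ ∀ j : Fin N, θ ≤ dist x (y j)

/-- **`pairMarker p`** — the `p`-COMPRESSED particles: some OTHER particle lies at distance `< p`. -/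
def pairMarker (p : ℝ) : SiteMarker := fun N y =>
  Finset.univ.filter fun k : Fin N => ∃ l : Fin N, l ≠ k ∧ dist (y l) (y k) < p

/-- **`defectMarker p θ = pairMarker p ∪ microvoidMarker θ`** — the METRIC DEFECT sites at compression threshold `p` and porosity threshold `θ`. -/
def defectMarker (p θ : ℝ) : SiteMarker := fun N y => pairMarker p N y ∪ microvoidMarker θ N y

/-- Membership in `microvoidMarker θ`, unfolded. [folklore] -/
theorem mem_microvoidMarker_iff {θ : ℝ} {N : ℕ} {y : Fin N → EuclideanSpace ℝ (Fin 3)} {i : Fin N} :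
    i ∈ microvoidMarker θ N y ↔ ∃ x : EuclideanSpace ℝ (Fin 3), dist x (y i) ≤ 2 ∧ ∀ j : Fin N, θ ≤ dist x (y j) := by
  simp [microvoidMarker]

/-- Membership in `pairMarker p`, unfolded. [folklore] -/
theorem mem_pairMarker_iff {p : ℝ} {N : ℕ} {y : Fin N → EuclideanSpace ℝ (Fin 3)} {k : Fin N} :
    k ∈ pairMarker p N y ↔ ∃ l : Fin N, l ≠ k ∧ dist (y l) (y k) < p := by
  simp [pairMarker]

/-- Membership in `defectMarker p θ`, unfolded. [folklore] -/
theorem mem_defectMarker_iff {p θ : ℝ} {N : ℕ} {y : Fin N → EuclideanSpace ℝ (Fin 3)} {k : Fin N} :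
    k ∈ defectMarker p θ N y ↔ k ∈ pairMarker p N y ∨ k ∈ microvoidMarker θ N y := by
  simp [defectMarker]

/-- Not microvoid-adjacent = every point of the particle's 2-ball lies within `< θ` of some particle (the COVERING reading). -/
theorem cover_of_not_mem_microvoidMarker {θ : ℝ} {N : ℕ} {y : Fin N → EuclideanSpace ℝ (Fin 3)} {k : Fin N}
    (hk : k ∉ microvoidMarker θ N y) : ∀ x : EuclideanSpace ℝ (Fin 3), dist x (y k) ≤ 2 → ∃ j : Fin N, dist x (y j) < θ := by
  intro x hx
  by_contra h
  push Not at h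
  exact hk (mem_microvoidMarker_iff.2 ⟨x, hx, h⟩)

/-- Not compressed = all other particles at distance `≥ p` (the PACKING reading). -/
theorem sep_of_not_mem_pairMarker {p : ℝ} {N : ℕ} {y : Fin N → EuclideanSpace ℝ (Fin 3)} {k : Fin N}
    (hk : k ∉ pairMarker p N y) : ∀ l : Fin N, l ≠ k → p ≤ dist (y l) (y k) := by
  intro l hl
  by_contra h
  exact hk (mem_pairMarker_iff.2 ⟨l, hl, lt_of_not_ge h⟩)

/-- `microvoidMarker 1` IS the 2-void-adjacent set of C's hypothesis. -/
theorem microvoidMarker_one_eq_voidAdjSet (N : ℕ) (y : Fin N → EuclideanSpace ℝ (Fin 3)) : microvoidMarker 1 N y = voidAdjSet 2 y := by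
  ext i
  simp [microvoidMarker, voidAdjSet]

/-- The microvoid marker is ANTITONE in the hole radius: `θ ≤ θ' ⟹ microvoidMarker θ' ⊆ microvoidMarker θ`. -/
theorem microvoidMarker_anti {θ θ' : ℝ} (h : θ ≤ θ') (N : ℕ) (y : Fin N → EuclideanSpace ℝ (Fin 3)) :
    microvoidMarker θ' N y ⊆ microvoidMarker θ N y := by
  intro i hi
  obtain ⟨x, hx, hfar⟩ := mem_microvoidMarker_iff.1 hi
  exact mem_microvoidMarker_iff.2 ⟨x, hx, fun j => h.trans (hfar j)⟩

/-- The pair marker is MONOTONE in the threshold: `p ≤ p' ⟹ pairMarker p ⊆ pairMarker p'`. -/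
theorem pairMarker_mono {p p' : ℝ} (h : p ≤ p') (N : ℕ) (y : Fin N → EuclideanSpace ℝ (Fin 3)) :
    pairMarker p N y ⊆ pairMarker p' N y := by
  intro k hk
  obtain ⟨l, hl, hd⟩ := mem_pairMarker_iff.1 hk
  exact mem_pairMarker_iff.2 ⟨l, hl, lt_of_lt_of_le hd h⟩

/-- In a Lennard-Jones ground state nobody is `7/10`-compressed (tree separation `7/10`). -/
theorem pairMarker_seven_tenths_eq_empty {N : ℕ} {y : Fin N → EuclideanSpace ℝ (Fin 3)} (hy : IsGroundState lennardJones y) :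
    pairMarker (7 / 10) N y = ∅ := by
  ext k
  simp only [Finset.notMem_empty, iff_false]
  intro hk
  obtain ⟨l, hl, hd⟩ := mem_pairMarker_iff.1 hk
  have := lennardJones_groundState_dist_ge_seven_tenths hy hl
  linarith

/-! ### §50.2 ★ THE SCALED COVERING LEMMA (pure geometry, PROVED): `BallCoveringBound 11 ρ` at hole radius `θ` -/

/-- **SCALED SPHERE-COVERING COUNT (PROVED).**  If `≤ 11` points never come within `< 1` of all of a sphere of radius `ρ ≥ 1`
(`BallCoveringBound 11 ρ`), then — scaling by `θ > 0` — `≤ 11` points never come within `< θ` of all of a sphere of radius `ρθ`; so a particle `k`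
whose 2-ball is covered by the OPEN `θ`-balls of the particles (`k` not `θ`-microvoid-adjacent, `ρθ ≤ 2`) has AT LEAST TWELVE other particles
within every `R ≥ θ(1+ρ)`: a point of `S(y_k, ρθ)` at distance `≥ θ` from the `≤ 11` near particles would be covered by nobody (`k` itself is at
distance `ρθ ≥ θ`, the far particles at distance `> R − ρθ ≥ θ`). -/
theorem twelve_le_card_of_ballCoveringBound_scaled {ρ θ : ℝ} (hE : BallCoveringBound 11 ρ) (hρ1 : 1 ≤ ρ) (hθ : 0 < θ)
    (hρθ : ρ * θ ≤ 2) {N : ℕ} (y : Fin N → EuclideanSpace ℝ (Fin 3)) (k : Fin N)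
    (hcov : ∀ x : EuclideanSpace ℝ (Fin 3), dist x (y k) ≤ 2 → ∃ j : Fin N, dist x (y j) < θ) {R : ℝ} (hR : θ * (1 + ρ) ≤ R) :
    12 ≤ (Finset.univ.filter fun l : Fin N => l ≠ k ∧ dist (y l) (y k) ≤ R).card := by
  classical
  by_contra hlt
  rw [not_le] at hlt
  set L : Finset (Fin N) := Finset.univ.filter fun l : Fin N => l ≠ k ∧ dist (y l) (y k) ≤ R with hL
  let g : EuclideanSpace ℝ (Fin 3) → EuclideanSpace ℝ (Fin 3) := fun z => y k + θ⁻¹ • (z - y k)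
  have hZ : ((L.image y).image g).card ≤ 11 :=
    le_trans Finset.card_image_le (le_trans Finset.card_image_le (by omega))
  obtain ⟨x₁, hx₁c, hx₁Z⟩ := hE (y k) ((L.image y).image g) hZ
  set x : EuclideanSpace ℝ (Fin 3) := y k + θ • (x₁ - y k) with hx
  have hxk : dist x (y k) = θ * ρ := by
    rw [hx, dist_eq_norm, add_sub_cancel_left, norm_smul, Real.norm_eq_abs, abs_of_pos hθ, ← dist_eq_norm, hx₁c]
  obtain ⟨j, hj⟩ := hcov x (by rw [hxk, mul_comm]; exact hρθ)
  have hjk : j ≠ k := by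
    rintro rfl
    rw [hxk] at hj
    nlinarith
  have hjL : j ∈ L := by
    rw [hL, Finset.mem_filter]
    refine ⟨Finset.mem_univ _, hjk, ?_⟩
    have h3 := dist_triangle (y j) x (y k)
    rw [dist_comm (y j) x, hxk] at h3
    nlinarith
  have hgj : g (y j) ∈ (L.image y).image g := Finset.mem_image_of_mem g (Finset.mem_image_of_mem y hjL)
  have h1 := hx₁Z (g (y j)) hgj
  have hscale : dist x (y j) = θ * dist x₁ (g (y j)) := by
    have : x - y j = θ • (x₁ - g (y j)) := by
      simp only [hx, g, smul_sub, smul_add, smul_smul, mul_inv_cancel₀ hθ.ne', one_smul]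
      abel
    rw [dist_eq_norm, this, norm_smul, Real.norm_eq_abs, abs_of_pos hθ, ← dist_eq_norm]
  have : θ ≤ dist x (y j) := by rw [hscale]; nlinarith
  linarith

/-- **Γ′ — THE POROSITY COUNT (PROVED modulo the cited covering fact via `BallCoveringBound 11 (8/5)`)**: a particle that is NOT `θ`-microvoid-adjacent
(`0 < θ ≤ 5/4`) has at least twelve other particles within `(13/5)·θ`.  At `θ = 7/10`: twelve within `91/50 = 1.82`; at `θ = 4/5`: twelve within
`52/25 = 2.08`. -/
theorem twelve_le_card_of_not_microvoid (hE : BallCoveringBound 11 (8 / 5)) {θ : ℝ} (hθ : 0 < θ) (hθ' : θ ≤ 5 / 4) {N : ℕ}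
    (y : Fin N → EuclideanSpace ℝ (Fin 3)) {k : Fin N} (hk : k ∉ microvoidMarker θ N y) {R : ℝ} (hR : 13 / 5 * θ ≤ R) :
    12 ≤ (Finset.univ.filter fun l : Fin N => l ≠ k ∧ dist (y l) (y k) ≤ R).card :=
  twelve_le_card_of_ballCoveringBound_scaled hE (by norm_num) hθ (by nlinarith) y k (cover_of_not_mem_microvoidMarker hk) (by nlinarith)

/-! ### §50.3 ★ LOOSENESS FORCES A METRIC DEFECT NEARBY (the enemy, described): per-particle structure theorems -/

/-- **★ GRADE 1 (GS-free!, PROVED mod the covering fact)**: a `δ`-looseF particle has, within distance 6, a particle that is `p`-COMPRESSED or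
`θ`-MICROVOID-ADJACENT, whenever `7/10 ≤ p ≤ 6/5`, `0 < θ ≤ 5/4` and `(13/5)θ ≤ (1+δ)p` — otherwise its 6-ball is `p`-separated and every particle
of its 5-ball has twelve others within `(1+δ)p` (Γ′), i.e. it is uniformly `δ`-tightF at scale `p`.  Of record: `(δ, p, θ) = (1, 91/100, 7/10)`. -/
theorem exists_defect_near_of_looseF (hE : BallCoveringBound 11 (8 / 5)) {δ p θ : ℝ} (hp : 7 / 10 ≤ p) (hp' : p ≤ 6 / 5) (hθ : 0 < θ)
    (hθ' : θ ≤ 5 / 4) (hδ : 13 / 5 * θ ≤ (1 + δ) * p) {N : ℕ} {y : Fin N → EuclideanSpace ℝ (Fin 3)} {j : Fin N}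
    (hj : j ∈ looseSetF δ y) : ∃ k : Fin N, dist (y k) (y j) ≤ 6 ∧ k ∈ defectMarker p θ N y := by
  by_contra h
  push Not at h
  have htight : UniformlyTightF δ p y j := by
    refine ⟨hp, hp', fun k l hkl hk hl => ?_, fun k hk => ?_⟩
    · have hk' : k ∉ pairMarker p N y := fun hm => h k hk (mem_defectMarker_iff.2 (Or.inl hm))
      have := sep_of_not_mem_pairMarker hk' l (Ne.symm hkl)
      rwa [dist_comm] at this
    · have hk' : k ∉ microvoidMarker θ N y := fun hm => h k (by linarith) (mem_defectMarker_iff.2 (Or.inr hm))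
      exact twelve_le_card_of_not_microvoid hE hθ hθ' y hk' hδ
  simp only [looseSetF, Finset.mem_filter, Finset.mem_univ, true_and] at hj
  exact hj p htight

/-- **★ OF RECORD at grade 1**: every 1-looseF particle has a `(91/100)`-compressed or `(7/10)`-microvoid-adjacent particle within distance 6
(`(13/5)·(7/10) = 91/50 = 2·(91/100)`).  [GEOMETRY · GS-free · PROVED mod `FejesToth1943_sphereCovering`] -/
theorem exists_defect_near_of_looseF_one (hFT : FejesToth1943_sphereCovering) {N : ℕ} {y : Fin N → EuclideanSpace ℝ (Fin 3)} {j : Fin N}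
    (hj : j ∈ looseSetF 1 y) : ∃ k : Fin N, dist (y k) (y j) ≤ 6 ∧ k ∈ defectMarker (91 / 100) (7 / 10) N y :=
  exists_defect_near_of_looseF (ballCoveringBound_eight_fifths_of_sphereCovering hFT) (by norm_num) (by norm_num) (by norm_num) (by norm_num)
    (by norm_num) hj

/-- **★ GRADE δ IN A GROUND STATE (PROVED mod the covering fact)**: a `δ`-looseF particle of a Lennard-Jones ground state has a `θ`-MICROVOID-ADJACENT
particle in its 5-ball whenever `(13/5)θ ≤ (1+δ)·(7/10)` (`0 < θ ≤ 5/4`) — the separation clause at the floor scale `7/10` is the tree's.  Of record: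
`(δ, θ) = (2, 4/5)`: 2-looseness forces `4/5`-microporosity (a vacancy-sized hole) within `5 + 2` of the particle; NO compression alternative. -/
theorem exists_microvoid_near_of_looseF_gs (hE : BallCoveringBound 11 (8 / 5)) {δ θ : ℝ} (hθ : 0 < θ) (hθ' : θ ≤ 5 / 4)
    (hδ : 13 / 5 * θ ≤ (1 + δ) * (7 / 10)) {N : ℕ} {y : Fin N → EuclideanSpace ℝ (Fin 3)} (hy : IsGroundState lennardJones y)
    {j : Fin N} (hj : j ∈ looseSetF δ y) : ∃ k : Fin N, dist (y k) (y j) ≤ 5 ∧ k ∈ microvoidMarker θ N y := by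
  by_contra h
  push Not at h
  have htight : UniformlyTightF δ (7 / 10) y j := by
    refine ⟨le_rfl, by norm_num, fun k l hkl _ _ => lennardJones_groundState_dist_ge_seven_tenths hy hkl, fun k hk => ?_⟩
    exact twelve_le_card_of_not_microvoid hE hθ hθ' y (h k hk) hδ
  simp only [looseSetF, Finset.mem_filter, Finset.mem_univ, true_and] at hj
  exact hj (7 / 10) htight

/-- **★ OF RECORD at grade 2**: every 2-looseF particle of a Lennard-Jones ground state has a `(4/5)`-microvoid-adjacent particle in its 5-ball
(`(13/5)·(4/5) = 52/25 ≤ 21/10 = 3·(7/10)`). [GEOMETRY + tree separation · PROVED mod `FejesToth1943_sphereCovering`] -/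
theorem exists_microvoid_near_of_looseF_two (hFT : FejesToth1943_sphereCovering) {N : ℕ} {y : Fin N → EuclideanSpace ℝ (Fin 3)}
    (hy : IsGroundState lennardJones y) {j : Fin N} (hj : j ∈ looseSetF 2 y) :
    ∃ k : Fin N, dist (y k) (y j) ≤ 5 ∧ k ∈ microvoidMarker (4 / 5) N y :=
  exists_microvoid_near_of_looseF_gs (ballCoveringBound_eight_fifths_of_sphereCovering hFT) (by norm_num) (by norm_num) (by norm_num) hy hj

/-! ### §50.4 ★ The UNMARKED pieces for the defect markers are THEOREMS (mod the covering fact) -/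

/-- **UNMARKED(microvoid θ; δ) — PROVED mod the fact** for `(13/5)θ ≤ (1+δ)(7/10)`: a 2-void-free all-`δ`-looseF chunk without `θ`-microvoid-adjacent
particles cannot have an occupied inner ball (radius `≥ 5`). -/
theorem unmarked_microvoid_of_ballCoveringBound (hE : BallCoveringBound 11 (8 / 5)) {δ θ : ℝ} (hθ : 0 < θ) (hθ' : θ ≤ 5 / 4)
    (hδ : 13 / 5 * θ ≤ (1 + δ) * (7 / 10)) : UnmarkedChunkExclusionF (microvoidMarker θ) δ := by
  refine ⟨5, fun r hr N y hy c hl _ hF i => ?_⟩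
  by_contra hin
  rw [not_lt] at hin
  obtain ⟨k, hk, hkm⟩ := exists_microvoid_near_of_looseF_gs hE hθ hθ' hδ hy (hl i (by linarith))
  exact hF k (by have := dist_triangle (y k) (y i) c; linarith) hkm

/-- **UNMARKED(defect p θ; δ) — PROVED mod the fact** for `7/10 ≤ p ≤ 6/5`, `(13/5)θ ≤ (1+δ)p` (radius `≥ 6`; GS-free in substance). -/
theorem unmarked_defect_of_ballCoveringBound (hE : BallCoveringBound 11 (8 / 5)) {δ p θ : ℝ} (hp : 7 / 10 ≤ p) (hp' : p ≤ 6 / 5)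
    (hθ : 0 < θ) (hθ' : θ ≤ 5 / 4) (hδ : 13 / 5 * θ ≤ (1 + δ) * p) : UnmarkedChunkExclusionF (defectMarker p θ) δ := by
  refine ⟨6, fun r hr N y hy c hl _ hF i => ?_⟩
  by_contra hin
  rw [not_lt] at hin
  obtain ⟨k, hk, hkm⟩ := exists_defect_near_of_looseF hE hp hp' hθ hθ' hδ (hl i (by linarith))
  exact hF k (by have := dist_triangle (y k) (y i) c; linarith) hkm

/-- **★ OF RECORD (7/5 lane)**: `UnmarkedChunkExclusionF (defectMarker (91/100) (7/10)) 1`. [PROVED mod `FejesToth1943_sphereCovering`] -/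
theorem unmarked_defect_one_sphereCovering (hFT : FejesToth1943_sphereCovering) :
    UnmarkedChunkExclusionF (defectMarker (91 / 100) (7 / 10)) 1 :=
  unmarked_defect_of_ballCoveringBound (ballCoveringBound_eight_fifths_of_sphereCovering hFT) (by norm_num) (by norm_num) (by norm_num)
    (by norm_num) (by norm_num)

/-- **★ OF RECORD (21/10 lane)**: `UnmarkedChunkExclusionF (microvoidMarker (4/5)) 2`. [PROVED mod `FejesToth1943_sphereCovering`] -/
theorem unmarked_microvoid_two_sphereCovering (hFT : FejesToth1943_sphereCovering) :
    UnmarkedChunkExclusionF (microvoidMarker (4 / 5)) 2 :=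
  unmarked_microvoid_of_ballCoveringBound (ballCoveringBound_eight_fifths_of_sphereCovering hFT) (by norm_num) (by norm_num) (by norm_num)

/-- The 21/10-lane piece for every `δ ≥ 2` and every hole radius `θ ≤ 4/5`. [PROVED mod the fact] -/
theorem unmarked_microvoid_of_sphereCovering (hFT : FejesToth1943_sphereCovering) {δ θ : ℝ} (hθ : 0 < θ) (hθ' : θ ≤ 4 / 5) (hδ : 2 ≤ δ) :
    UnmarkedChunkExclusionF (microvoidMarker θ) δ :=
  unmarked_microvoid_of_ballCoveringBound (ballCoveringBound_eight_fifths_of_sphereCovering hFT) hθ (by linarith) (by nlinarith)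

/-! ### §50.5 ★ EXACT REFORMULATIONS (0 EQUIV mod the fact): the upper ladder as ONE co-marked piece per lane -/

/-- **★ NLC_F(2) ⟺ COMARKED(microvoid 4/5; 2, 27/10)** (mod the fact): «no large all-2-looseF 2-void-free ground-state chunks in which BOTH the
`27/10`-tightF particles AND the `4/5`-microvoid-adjacent particles are dense».  [kernel `noLooseChunksF_iff_unmarked_comarked` at `(2, 27/10)` +
`unmarked_microvoid_two_sphereCovering` + the covering rung NLC_F(27/10)] -/
theorem noLooseChunksF_two_iff_comarked_microvoid_sphereCovering (hFT : FejesToth1943_sphereCovering) :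
    NoLooseChunksF 2 ↔ CoMarkedBandExclusionF (microvoidMarker (4 / 5)) 2 (27 / 10) := by
  rw [noLooseChunksF_iff_unmarked_comarked (microvoidMarker (4 / 5)) (show (2 : ℝ) ≤ 27 / 10 by norm_num)]
  exact ⟨fun h => h.2.1, fun h => ⟨unmarked_microvoid_two_sphereCovering hFT, h, noLooseChunksF_27_10_of_sphereCovering hFT⟩⟩

/-- **★ BAND_F(2, 27/10) ⟺ COMARKED(microvoid 4/5; 2, 27/10)** (mod the fact). -/
theorem bandExclusionF_two_27_iff_comarked_microvoid_sphereCovering (hFT : FejesToth1943_sphereCovering) :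
    BandExclusionF 2 (27 / 10) ↔ CoMarkedBandExclusionF (microvoidMarker (4 / 5)) 2 (27 / 10) := by
  rw [← noLooseChunksF_two_iff_band27_of_sphereCovering hFT, noLooseChunksF_two_iff_comarked_microvoid_sphereCovering hFT]

/-- **★ NLC_F(1) ⟺ COMARKED(defect 91/100, 7/10; 1, 27/10)** (mod the fact): the WHOLE upper ladder from grade 1 is ONE co-marked piece — «no large
all-1-looseF 2-void-free ground-state chunks in which both the `27/10`-tightF particles and the METRIC DEFECT sites (a partner closer than `91/100`, or
a `7/10`-hole within 2) are dense». -/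
theorem noLooseChunksF_one_iff_comarked_defect_sphereCovering (hFT : FejesToth1943_sphereCovering) :
    NoLooseChunksF 1 ↔ CoMarkedBandExclusionF (defectMarker (91 / 100) (7 / 10)) 1 (27 / 10) := by
  rw [noLooseChunksF_iff_unmarked_comarked (defectMarker (91 / 100) (7 / 10)) (show (1 : ℝ) ≤ 27 / 10 by norm_num)]
  exact ⟨fun h => h.2.1, fun h => ⟨unmarked_defect_one_sphereCovering hFT, h, noLooseChunksF_27_10_of_sphereCovering hFT⟩⟩

/-- **BAND_F(1,2) ⟺ COMARKED(defect 91/100, 7/10; 1, 2) given NLC_F(2)** (the band-level form; kernel `bandExclusionF_iff_unmarked_comarked`). -/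
theorem bandExclusionF_one_two_iff_comarked_defect (hFT : FejesToth1943_sphereCovering) (hN2 : NoLooseChunksF 2) :
    BandExclusionF 1 2 ↔ CoMarkedBandExclusionF (defectMarker (91 / 100) (7 / 10)) 1 2 := by
  rw [bandExclusionF_iff_unmarked_comarked (defectMarker (91 / 100) (7 / 10)) hN2]
  exact ⟨fun h => h.2, fun h => ⟨unmarked_defect_one_sphereCovering hFT, h⟩⟩

/-- **NLC_F(1) ⟺ BAND_F(1,2)-as-defect-piece ∧ NLC_F(2)-as-microvoid-piece** (mod the fact; the two-lane form). -/
theorem noLooseChunksF_one_iff_defect_microvoid_sphereCovering (hFT : FejesToth1943_sphereCovering) :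
    NoLooseChunksF 1 ↔ CoMarkedBandExclusionF (defectMarker (91 / 100) (7 / 10)) 1 2 ∧
      CoMarkedBandExclusionF (microvoidMarker (4 / 5)) 2 (27 / 10) := by
  rw [noLooseChunksF_iff_band (show (1 : ℝ) ≤ 2 by norm_num), ← noLooseChunksF_two_iff_comarked_microvoid_sphereCovering hFT]
  constructor
  · rintro ⟨hN2, hB⟩
    exact ⟨(bandExclusionF_one_two_iff_comarked_defect hFT hN2).1 hB, hN2⟩
  · rintro ⟨hD, hN2⟩
    exact ⟨hN2, (bandExclusionF_one_two_iff_comarked_defect hFT hN2).2 hD⟩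

/-- The co-marked defect piece is WEAKER than NLC_F(1) by name; the co-marked microvoid piece WEAKER than NLC_F(2) (formal). -/
theorem comarked_defect_of_noLooseChunksF_one (h : NoLooseChunksF 1) :
    CoMarkedBandExclusionF (defectMarker (91 / 100) (7 / 10)) 1 2 ∧ CoMarkedBandExclusionF (defectMarker (91 / 100) (7 / 10)) 1 (27 / 10) :=
  ⟨coMarkedBandExclusionF_of_noLooseChunksF _ h, coMarkedBandExclusionF_of_noLooseChunksF _ h⟩

/-- The co-marked microvoid piece is WEAKER than NLC_F(2) by name (formal). -/
theorem comarked_microvoid_of_noLooseChunksF_two (h : NoLooseChunksF 2) :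
    CoMarkedBandExclusionF (microvoidMarker (4 / 5)) 2 (27 / 10) :=
  coMarkedBandExclusionF_of_noLooseChunksF _ h

/-- Both residual pieces are WEAKER than the residual NLC of C (certified by name). -/
theorem comarked_defect_of_noLooseChunks (h : NoLooseChunks) :
    CoMarkedBandExclusionF (defectMarker (91 / 100) (7 / 10)) 1 2 ∧ CoMarkedBandExclusionF (microvoidMarker (4 / 5)) 2 (27 / 10) :=
  ⟨coMarkedBandExclusionF_of_noLooseChunks _ (by norm_num) h, coMarkedBandExclusionF_of_noLooseChunks _ (by norm_num) h⟩

end DefectMarker50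

end Summit.AtomisticToContinuum.Crystallization.Theorems.ContactSaturationLadderDefectMarker

end
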